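import Mathlib

/-!
# Crux `FermionicNormalForm` (item `stmt-ValiantsHypothesis-6283`), line `birth`, stub `stub_smallSupportRepr` (B1a)

Crux `Summit.ValiantsHypothesis.ValiantsHypothesis.Theses.TwistedDetRank.FermionicNormalForm`,
line `birth` (`Cruxes/FermionicNormalForm/Lines/birth.lean`), registered stub
`stub_smallSupportRepr` — the perturbative end of the fermionic normal form, in coefficient form.

For `n ≥ 1`, the class function `σ ↦ [#supp σ ≤ w] · G (cycleType σ)` on `Perm (Fin n)` is the sum
of exactly `#{π : #supp π ≤ w}` elementary cone elements `σ ↦ sgn σ · ∏ᵢ E_π (σ i) i`, one per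
such `π`: `E_π` is the permutation matrix of `π` whose column `0` is scaled by
`sgn π · G (cycleType π)`, so that `∏ᵢ E_π (σ i) i = [σ = π] · sgn π · G (cycleType π)` and
`sgn σ · sgn σ = 1`.
-/

-- single-conjunct layout: Sub = Summit, duplicated namespace component intended
set_option linter.dupNamespace false

namespace Summit.ValiantsHypothesis.ValiantsHypothesis.Theorems.TwistedDetRankFermionicNormalForm

open Equiv

/-- Diagonal product, along a permutation `σ`, of the permutation matrix of `π` with column `i₀`
scaled by `a`: `∏ᵢ [σ i = π i] · (if i = i₀ then a else 1)` is `a` if `σ = π` and `0` otherwise. -/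
private theorem prod_ite_perm_eq {n : ℕ} (σ π : Perm (Fin n)) (i₀ : Fin n) (a : ℂ) :
    ∏ i, (if σ i = π i then (if i = i₀ then a else 1) else (0 : ℂ)) = if σ = π then a else 0 := by
  by_cases h : σ = π
  · subst h
    simp
  · obtain ⟨i, hi⟩ : ∃ i, σ i ≠ π i := not_forall.mp (mt Equiv.ext h)
    rw [if_neg h]
    exact Finset.prod_eq_zero (Finset.mem_univ i) (if_neg hi)

/-- The indicator-weighted function `σ ↦ [σ ∈ A] · a σ` is the sum, over `π ∈ A` enumerated by
`Fin A.card`, of the elementary cone elements `σ ↦ sgn σ · ∏ᵢ E_π (σ i) i` of the permutation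
matrices `E_π` of `π` with column `i₀` scaled by `sgn π · a π`. -/
private theorem exists_repr_indicator {n : ℕ} (A : Finset (Perm (Fin n))) (a : Perm (Fin n) → ℂ)
    (i₀ : Fin n) :
    ∃ E : Fin A.card → Matrix (Fin n) (Fin n) ℂ, ∀ σ : Perm (Fin n),
      (if σ ∈ A then a σ else 0) = ∑ t, ((Equiv.Perm.sign σ : ℤ) : ℂ) * ∏ i, E t (σ i) i := by
  refine ⟨fun t i j =>
      if i = (A.equivFin.symm t : Perm (Fin n)) j then
        (if j = i₀ then
          ((Equiv.Perm.sign (A.equivFin.symm t : Perm (Fin n)) : ℤ) : ℂ) * a (A.equivFin.symm t)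
        else 1)
      else 0,
    fun σ => ?_⟩
  simp_rw [prod_ite_perm_eq]
  rw [Equiv.sum_comp A.equivFin.symm (fun π : A => ((Equiv.Perm.sign σ : ℤ) : ℂ) *
        if σ = (π : Perm (Fin n)) then ((Equiv.Perm.sign (π : Perm (Fin n)) : ℤ) : ℂ) * a π else 0),
    Finset.sum_coe_sort A (fun π => ((Equiv.Perm.sign σ : ℤ) : ℂ) *
        if σ = π then ((Equiv.Perm.sign π : ℤ) : ℂ) * a π else 0),
    ← Finset.mul_sum, Finset.sum_ite_eq, mul_ite, mul_zero, ← mul_assoc, ← Int.cast_mul,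
    Int.units_coe_mul_self, Int.cast_one, one_mul]

/-- **Stub B1a** (`stub_smallSupportRepr`, perturbative end, coefficient form): for `n ≥ 1` the
class function `σ ↦ [#supp σ ≤ w] · G (cycleType σ)` on `Perm (Fin n)` is a sum of exactly
`#{π : #supp π ≤ w}` elementary cone elements `σ ↦ sgn σ · ∏ᵢ E_t (σ i) i` — one per such `π`,
`E_π` the permutation matrix of `π` with column `0` scaled by `sgn π · G (cycleType π)`
(this is where `1 ≤ n` is used). -/
theorem stub_smallSupportRepr :
    ∀ (n w : ℕ) (G : Multiset ℕ → ℂ), 1 ≤ n →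
      ∃ (r : ℕ) (E : Fin r → Matrix (Fin n) (Fin n) ℂ),
        r = (Finset.univ.filter fun π : Equiv.Perm (Fin n) => π.support.card ≤ w).card ∧
        ∀ σ : Equiv.Perm (Fin n),
          (if σ.support.card ≤ w then G σ.cycleType else 0) =
            ∑ t, ((Equiv.Perm.sign σ : ℤ) : ℂ) * ∏ i, E t (σ i) i := by
  intro n w G hn
  obtain ⟨E, hE⟩ := exists_repr_indicator
    (Finset.univ.filter fun π : Equiv.Perm (Fin n) => π.support.card ≤ w)
    (fun σ => G σ.cycleType) ⟨0, hn⟩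
  refine ⟨_, E, rfl, fun σ => ?_⟩
  rw [← hE σ]
  simp only [Finset.mem_filter, Finset.mem_univ, true_and]

end Summit.ValiantsHypothesis.ValiantsHypothesis.Theorems.TwistedDetRankFermionicNormalForm
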